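import Mathlib.Algebra.Order.BigOperators.Group.Finset
import Mathlib.Algebra.Order.Group.Abs
import Mathlib.Data.Real.Basic
import Mathlib.Data.Int.Interval
import Mathlib.Data.Fintype.Pi
import Literature.Combinatorics.Additive.SliceRankMethod
import Literature.Combinatorics.Additive.TripleProductProperty
import HarnessLib

/-!
# Border tricolored sum-free sets and STPP constructions (BCCGNSU 2017, §3.1)

Topic: `Literature/Combinatorics/Additive`. Section 3.1 of
Blasiak–Church–Cohn–Grochow–Naslund–Sawin–Umans 2017, PROVED:

* `IsBorderTricoloredSumFree s t u α β γ` — **Def. 3.2** (border tricolored sum-free set: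
  families `s, t, u : ι → H` with integer weights such that `s i + t j + u k = 0` forces
  `α i + β j + γ k ≥ 0`, with equality exactly on the matching), functional form;
* `IsBorderTricoloredSumFree.pi`, `IsBorderTricoloredSumFree.exists_isTricoloredSumFree_pi` —
  **Lemma 3.4**: from a border tricolored sum-free set of size `|M|` whose weights are bounded by
  `R`, a tricolored sum-free set in `H^N` of size `≥ |M|^N / (2NR+1)^2` (the printed statement
  has `(2Nt+1)^3`; the printed pigeon-hole proof gives the square since `γ = -α-β` on the
  matching);
* `AddSimultaneousTPP.exists_isBorderTricoloredSumFree` — **Thm. 3.3**: an STPP construction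
  `(Aᵢ, Bᵢ, Cᵢ)` in an abelian group (the tree's `AddSimultaneousTPP`,
  `Literature/Combinatorics/Additive/TripleProductProperty.lean`) yields a border tricolored
  sum-free set of size `≥ Σᵢ |Aᵢ||Bᵢ||Cᵢ| / (|Aᵢ|+|Bᵢ|+|Cᵢ|)`, by the printed construction
  (most popular rank sum `rᵢ`, families `a-b, b-c, c-a`, quadratic weights completing the
  square `(ρ(a)+ρ(b)+ρ(c)-rᵢ)²`).

## References

* J. Blasiak, T. Church, H. Cohn, J. A. Grochow, E. Naslund, W. F. Sawin, C. Umans, *On cap sets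
  and the group-theoretic approach to matrix multiplication*, Discrete Analysis 2017:3,
  arXiv:1605.06702, §3.1: Def. 3.1, Def. 3.2, Thm. 3.3 (p. 7, proof pp. 7–8), Lemma 3.4 with
  proof (p. 8). (Page numbers of the held 19-page PDF, `lit read arxiv:1605.06702 --pages …`.)

## Design notes

* Functional form throughout (families indexed by a type instead of subsets with a perfect
  matching); see the docstrings of `IsTricoloredSumFree` (in `SliceRankMethod.lean`) and
  `IsBorderTricoloredSumFree` for the comparison with Defs. 3.1/3.2.
* The index set produced by Thm. 3.3 is a `Finset` of `Σ _ : ι₀, H × H × H` (triples `(a,b,c)`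
  tagged by their block `i`), coerced to a type.
-/

namespace Literature.Combinatorics.Additive

open Finset

section Border

variable {H : Type*} [AddCommGroup H] {ι : Type*}

/-- **Border tricolored sum-free set** (BCCGNSU 2017, Def. 3.2), functional form: families
`s t u : ι → H` and integer weights `α β γ : ι → ℤ` such that (i) `s i + t i + u i = 0` and
`α i + β i + γ i = 0` on the matching; (ii) whenever `s i + t j + u k = 0` the weight
`α i + β j + γ k` is `≥ 0`, and (iii) it vanishes only on the matching `i = j = k`. (Def. 3.2 is
the case where moreover `s, t, u` are injective, i.e. enumerate sets `S, T, U`, with the weights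
functions on these sets; this is not needed for Lemma 3.4 and not recorded. The *range* of
Def. 3.2 is `max |α|, |β|, |γ|`.) [cite: BlasiakChurchCohnGrochowNaslundSawinUmans2017, Def. 3.2] -/
def IsBorderTricoloredSumFree (s t u : ι → H) (α β γ : ι → ℤ) : Prop :=
  (∀ i, s i + t i + u i = 0 ∧ α i + β i + γ i = 0) ∧
  (∀ i j k, s i + t j + u k = 0 → 0 ≤ α i + β j + γ k) ∧
  (∀ i j k, s i + t j + u k = 0 → α i + β j + γ k = 0 → i = j ∧ j = k)

/-- A border tricolored sum-free set with identically vanishing weights is a tricolored sum-free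
set (last paragraph of the proof of BCCGNSU 2017, Lemma 3.4).
[cite: BlasiakChurchCohnGrochowNaslundSawinUmans2017, Lemma 3.4 (proof)] -/
theorem IsBorderTricoloredSumFree.isTricoloredSumFree_of_weights_eq {s t u : ι → H}
    {α β γ : ι → ℤ} (h : IsBorderTricoloredSumFree s t u α β γ) (a b : ℤ)
    (hα : ∀ i, α i = a) (hβ : ∀ i, β i = b) : IsTricoloredSumFree s t u := by
  intro i j k
  constructor
  · intro h0
    refine h.2.2 i j k h0 ?_
    have hk := (h.1 k).2
    rw [hα, hβ] at hk ⊢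
    exact hk
  · rintro ⟨rfl, rfl⟩
    exact (h.1 i).1

/-- **Powers of a border tricolored sum-free set** (BCCGNSU 2017, proof of Lemma 3.4, first
paragraph): coordinatewise `s`, `t`, `u` on `ι^N` with summed weights is again a border
tricolored sum-free set (in `H^N`).
[cite: BlasiakChurchCohnGrochowNaslundSawinUmans2017, Lemma 3.4 (proof)] -/
theorem IsBorderTricoloredSumFree.pi {s t u : ι → H} {α β γ : ι → ℤ}
    (h : IsBorderTricoloredSumFree s t u α β γ) (N : ℕ) :
    IsBorderTricoloredSumFree (ι := Fin N → ι) (H := Fin N → H)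
      (fun I l => s (I l)) (fun I l => t (I l)) (fun I l => u (I l))
      (fun I => ∑ l, α (I l)) (fun I => ∑ l, β (I l)) (fun I => ∑ l, γ (I l)) := by
  refine ⟨fun I => ⟨funext fun l => (h.1 (I l)).1, ?_⟩, fun I J K h0 => ?_, fun I J K h0 hw => ?_⟩
  · rw [← Finset.sum_add_distrib, ← Finset.sum_add_distrib]
    exact Finset.sum_eq_zero fun l _ => (h.1 (I l)).2
  · rw [← Finset.sum_add_distrib, ← Finset.sum_add_distrib]
    exact Finset.sum_nonneg fun l _ => h.2.1 _ _ _ (congr_fun h0 l)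
  · rw [← Finset.sum_add_distrib, ← Finset.sum_add_distrib] at hw
    have hl := (Finset.sum_eq_zero_iff_of_nonneg fun l _ => h.2.1 _ _ _ (congr_fun h0 l)).1 hw
    constructor
    · exact funext fun l => (h.2.2 _ _ _ (congr_fun h0 l) (hl l (mem_univ _))).1
    · exact funext fun l => (h.2.2 _ _ _ (congr_fun h0 l) (hl l (mem_univ _))).2

/-- **BCCGNSU 2017, Lemma 3.4** ("Let `H` be an abelian group in which there is a border
tricolored sum-free set of cardinality `|M|` and range `t`. Then for each natural number `N`,
there exists a tricolored sum-free set in `H^N` of cardinality at least `|M|^N/(2Nt+1)^3`"),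
effective functional form with the slightly better denominator `(2Nt+1)^2` that the printed
pigeon-hole argument gives (the classes are determined by `(α, β)` since `α + β + γ = 0`): the
tricolored sum-free set is the sub-family of `ι^N` on which the summed weights take a most
popular value. [cite: BlasiakChurchCohnGrochowNaslundSawinUmans2017, Lemma 3.4] -/
theorem IsBorderTricoloredSumFree.exists_isTricoloredSumFree_pi [Fintype ι]
    {s t u : ι → H} {α β γ : ι → ℤ} (h : IsBorderTricoloredSumFree s t u α β γ) (R : ℕ)
    (hR : ∀ i, |α i| ≤ R ∧ |β i| ≤ R) (N : ℕ) :
    ∃ M : Finset (Fin N → ι),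
      IsTricoloredSumFree (H := Fin N → H) (fun I : M => fun l => s (I.1 l))
        (fun I : M => fun l => t (I.1 l)) (fun I : M => fun l => u (I.1 l)) ∧
      Fintype.card ι ^ N ≤ (2 * N * R + 1) ^ 2 * M.card := by
  classical
  have hpi := h.pi N
  set wA : (Fin N → ι) → ℤ := fun I => ∑ l, α (I l) with hwA
  set wB : (Fin N → ι) → ℤ := fun I => ∑ l, β (I l) with hwB
  set f : (Fin N → ι) → ℤ × ℤ := fun I => (wA I, wB I) with hf
  set T : Finset (ℤ × ℤ) :=
    (Finset.Icc (-(N * R : ℤ)) (N * R)) ×ˢ (Finset.Icc (-(N * R : ℤ)) (N * R)) with hT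
  have hmaps : ∀ I ∈ (univ : Finset (Fin N → ι)), f I ∈ T := by
    intro I _
    have hb : ∀ (w : ι → ℤ), (∀ i, |w i| ≤ R) → |∑ l, w (I l)| ≤ N * R := by
      intro w hw
      calc |∑ l, w (I l)| ≤ ∑ l, |w (I l)| := Finset.abs_sum_le_sum_abs _ _
        _ ≤ ∑ _l : Fin N, (R : ℤ) := Finset.sum_le_sum fun l _ => hw (I l)
        _ = N * R := by simp
    have hA := hb α fun i => (hR i).1
    have hB := hb β fun i => (hR i).2
    simp only [hT, hf, Finset.mem_product, Finset.mem_Icc]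
    exact ⟨abs_le.1 hA, abs_le.1 hB⟩
  have hTcard : T.card = (2 * N * R + 1) ^ 2 := by
    have h1 : (Finset.Icc (-(N * R : ℤ)) (N * R)).card = 2 * N * R + 1 := by
      rw [Int.card_Icc]
      have : (N * R : ℤ) + 1 - -(N * R : ℤ) = ((2 * N * R + 1 : ℕ) : ℤ) := by push_cast; ring
      rw [this, Int.toNat_natCast]
    rw [hT, Finset.card_product, h1, sq]
  have hTne : T.Nonempty := by
    have h0 : (0 : ℤ) ≤ N * R := by positivity
    refine ⟨(0, 0), ?_⟩
    simp only [hT, Finset.mem_product, Finset.mem_Icc]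
    exact ⟨⟨by linarith, h0⟩, by linarith, h0⟩
  obtain ⟨y, hyT, hmax⟩ := T.exists_max_image (fun y => (univ.filter fun I => f I = y).card) hTne
  set M : Finset (Fin N → ι) := univ.filter fun I => f I = y with hM
  refine ⟨M, ?_, ?_⟩
  · -- on `M` the weights are constant, so the border set is a genuine one
    refine IsBorderTricoloredSumFree.isTricoloredSumFree_of_weights_eq (α := fun I : M => wA I.1)
      (β := fun I : M => wB I.1) (γ := fun I : M => ∑ l, γ (I.1 l)) ?_ y.1 y.2 ?_ ?_
    · refine ⟨fun I => hpi.1 I.1, fun I J K h0 => hpi.2.1 I.1 J.1 K.1 h0, fun I J K h0 hw => ?_⟩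
      have := hpi.2.2 I.1 J.1 K.1 h0 hw
      exact ⟨Subtype.ext this.1, Subtype.ext this.2⟩
    · intro I
      have hI := (mem_filter.1 I.2).2
      simp only [hf, Prod.ext_iff] at hI
      exact hI.1
    · intro I
      have hI := (mem_filter.1 I.2).2
      simp only [hf, Prod.ext_iff] at hI
      exact hI.2
  · -- counting
    have hsum := Finset.card_eq_sum_card_fiberwise hmaps
    rw [card_univ, Fintype.card_pi, Finset.prod_const, card_univ, Fintype.card_fin] at hsum
    rw [hsum, ← hTcard]
    calc ∑ b ∈ T, (univ.filter fun I : Fin N → ι => f I = b).card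
        ≤ ∑ _b ∈ T, M.card := Finset.sum_le_sum fun b hb => hmax b hb
      _ = T.card * M.card := by rw [Finset.sum_const, smul_eq_mul]

end Border

/-! ### Theorem 3.3: STPP constructions yield border tricolored sum-free sets -/

section STPP

variable {H : Type*} [AddCommGroup H] [DecidableEq H] {ι₀ : Type*} [Fintype ι₀]

/-- Ranks: an injection of a finite set `S ⊆ H` into `{0, …, |S|-1}` (the bijections
`αᵢ, βᵢ, γᵢ` identifying `Aᵢ, Bᵢ, Cᵢ` with `[nᵢ], [mᵢ], [pᵢ]` in the proof of BCCGNSU Thm. 3.3);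
junk value `0` off `S`. [cite: BlasiakChurchCohnGrochowNaslundSawinUmans2017, Thm. 3.3 (proof)] -/
noncomputable def finsetRank (S : Finset H) (a : H) : ℕ :=
  if h : a ∈ S then ((S.equivFin ⟨a, h⟩ : Fin S.card) : ℕ) else 0

omit [AddCommGroup H] in
/-- Ranks are `< |S|` on `S`. [folklore] -/
theorem finsetRank_lt {S : Finset H} {a : H} (ha : a ∈ S) : finsetRank S a < S.card := by
  simp only [finsetRank, dif_pos ha]
  exact Fin.is_lt _

omit [AddCommGroup H] in
/-- Ranks are injective on `S`. [folklore] -/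
theorem finsetRank_injOn {S : Finset H} {a a' : H} (ha : a ∈ S) (ha' : a' ∈ S)
    (h : finsetRank S a = finsetRank S a') : a = a' := by
  simp only [finsetRank, dif_pos ha, dif_pos ha'] at h
  have := (S.equivFin).injective (Fin.ext h)
  exact congrArg Subtype.val this

omit [AddCommGroup H] in
/-- The most popular value of `rank a + rank b + rank c` on `A × B × C` is attained at least
`|A||B||C| / (|A|+|B|+|C|)` times ("Let `rᵢ` be the most frequently occurring value in the
multiset `{x+y+z}` … `|Mᵢ| ≥ |Aᵢ||Bᵢ||Cᵢ|/(|Aᵢ|+|Bᵢ|+|Cᵢ|)`", proof of BCCGNSU Thm. 3.3).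
[cite: BlasiakChurchCohnGrochowNaslundSawinUmans2017, Thm. 3.3 (proof)] -/
theorem exists_popular_rankSum (A B C : Finset H) :
    ∃ r : ℕ, A.card * B.card * C.card ≤ (A.card + B.card + C.card) *
      ((A ×ˢ B ×ˢ C).filter fun x =>
        finsetRank A x.1 + finsetRank B x.2.1 + finsetRank C x.2.2 = r).card := by
  classical
  set box := A ×ˢ B ×ˢ C with hbox
  set g : H × H × H → ℕ := fun x => finsetRank A x.1 + finsetRank B x.2.1 + finsetRank C x.2.2
    with hg
  set vals := Finset.range (A.card + B.card + C.card) with hvals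
  have hmaps : ∀ x ∈ box, g x ∈ vals := by
    rintro ⟨a, b, c⟩ hx
    simp only [hbox, Finset.mem_product] at hx
    simp only [hvals, hg, Finset.mem_range]
    have h1 := finsetRank_lt hx.1
    have h2 := finsetRank_lt hx.2.1
    have h3 := finsetRank_lt hx.2.2
    omega
  by_cases hne : vals.Nonempty
  · obtain ⟨r, hr, hmax⟩ := vals.exists_max_image (fun v => (box.filter fun x => g x = v).card) hne
    refine ⟨r, ?_⟩
    have hsum := Finset.card_eq_sum_card_fiberwise hmaps
    have hboxcard : box.card = A.card * B.card * C.card := by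
      rw [hbox, Finset.card_product, Finset.card_product, mul_assoc]
    rw [← hboxcard, hsum]
    calc ∑ v ∈ vals, (box.filter fun x => g x = v).card
        ≤ ∑ _v ∈ vals, (box.filter fun x => g x = r).card := Finset.sum_le_sum fun v hv => hmax v hv
      _ = (A.card + B.card + C.card) * (box.filter fun x => g x = r).card := by
          rw [Finset.sum_const, smul_eq_mul, hvals, Finset.card_range]
  · refine ⟨0, ?_⟩
    have h0 : A.card + B.card + C.card = 0 := by
      by_contra h0
      exact hne ⟨0, Finset.mem_range.2 (Nat.pos_of_ne_zero h0)⟩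
    have hA : A.card = 0 := by omega
    rw [hA, zero_mul, zero_mul]
    exact Nat.zero_le _

/-- **BCCGNSU 2017, Thm. 3.3** ("Let `Aᵢ, Bᵢ, Cᵢ ⊆ H` be an STPP construction in an abelian group
`H`. Then there is a border tricolored sum-free set in `H` of cardinality at least
`Σᵢ |Aᵢ||Bᵢ||Cᵢ| / (|Aᵢ| + |Bᵢ| + |Cᵢ|)`"), with the construction of the printed proof: the index
set is `M = ⋃ᵢ Mᵢ`, `Mᵢ = {(a,b,c) ∈ Aᵢ × Bᵢ × Cᵢ : rank a + rank b + rank c = rᵢ}` for a most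
popular value `rᵢ`, the three families are `a - b`, `b - c`, `c - a`, and the weights are
`α = ρ(a)² + 2ρ(a)ρ(b) - 2ρ(a)rᵢ + rᵢ²`, `β = ρ(b)² + 2ρ(b)ρ(c) - 2ρ(b)rᵢ`,
`γ = ρ(c)² + 2ρ(c)ρ(a) - 2ρ(c)rᵢ` (so that `α + β + γ = (ρ(a)+ρ(b)+ρ(c)-rᵢ)²` whenever the
three group elements sum to zero). The STPP is the tree's `AddSimultaneousTPP` (CKSU Def. 5.1 =
BCCGNSU Def. 2.2). [cite: BlasiakChurchCohnGrochowNaslundSawinUmans2017, Thm. 3.3] -/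
theorem AddSimultaneousTPP.exists_isBorderTricoloredSumFree {A B C : ι₀ → Finset H}
    (hS : AddSimultaneousTPP A B C) :
    ∃ (M : Finset (Σ _ : ι₀, H × H × H)) (α β γ : (Σ _ : ι₀, H × H × H) → ℤ),
      IsBorderTricoloredSumFree
        (fun x : M => x.1.2.1 - x.1.2.2.1) (fun x : M => x.1.2.2.1 - x.1.2.2.2)
        (fun x : M => x.1.2.2.2 - x.1.2.1) (fun x : M => α x.1) (fun x : M => β x.1)
        (fun x : M => γ x.1) ∧
      ∑ i, ((A i).card * (B i).card * (C i).card : ℝ) / ((A i).card + (B i).card + (C i).card)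
        ≤ M.card := by
  classical
  rw [addSimultaneousTPP_iff_forall] at hS
  choose r hr using fun i => exists_popular_rankSum (A i) (B i) (C i)
  -- notation for ranks
  set ρA : ι₀ → H → ℤ := fun i a => (finsetRank (A i) a : ℤ) with hρA
  set ρB : ι₀ → H → ℤ := fun i b => (finsetRank (B i) b : ℤ) with hρB
  set ρC : ι₀ → H → ℤ := fun i c => (finsetRank (C i) c : ℤ) with hρC
  set Mi : ∀ i : ι₀, Finset (H × H × H) := fun i => ((A i) ×ˢ (B i) ×ˢ (C i)).filter fun x =>
    finsetRank (A i) x.1 + finsetRank (B i) x.2.1 + finsetRank (C i) x.2.2 = r i with hMi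
  set M : Finset (Σ _ : ι₀, H × H × H) := univ.sigma Mi with hM
  set α : (Σ _ : ι₀, H × H × H) → ℤ := fun x =>
    ρA x.1 x.2.1 ^ 2 + 2 * ρA x.1 x.2.1 * ρB x.1 x.2.2.1 - 2 * ρA x.1 x.2.1 * r x.1 +
      (r x.1 : ℤ) ^ 2 with hα
  set β : (Σ _ : ι₀, H × H × H) → ℤ := fun x =>
    ρB x.1 x.2.2.1 ^ 2 + 2 * ρB x.1 x.2.2.1 * ρC x.1 x.2.2.2 - 2 * ρB x.1 x.2.2.1 * r x.1 with hβ
  set γ : (Σ _ : ι₀, H × H × H) → ℤ := fun x =>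
    ρC x.1 x.2.2.2 ^ 2 + 2 * ρC x.1 x.2.2.2 * ρA x.1 x.2.1 - 2 * ρC x.1 x.2.2.2 * r x.1 with hγ
  -- membership in `M`
  have hmem : ∀ x : M, x.1.2.1 ∈ A x.1.1 ∧ x.1.2.2.1 ∈ B x.1.1 ∧ x.1.2.2.2 ∈ C x.1.1 ∧
      ρA x.1.1 x.1.2.1 + ρB x.1.1 x.1.2.2.1 + ρC x.1.1 x.1.2.2.2 = r x.1.1 := by
    rintro ⟨⟨i, a, b, c⟩, hx⟩
    simp only [hM, hMi, Finset.mem_sigma, Finset.mem_univ, true_and, Finset.mem_filter,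
      Finset.mem_product] at hx
    refine ⟨hx.1.1, hx.1.2.1, hx.1.2.2, ?_⟩
    simp only [hρA, hρB, hρC]
    exact_mod_cast hx.2
  have key0 : ∀ a b c : H, (a - b) + (b - c) + (c - a) = 0 := fun a b c => by abel
  have key1 : ∀ a b b' c' c'' a'' : H,
      (a - a'') + (b' - b) + (c'' - c') = (a - b) + (b' - c') + (c'' - a'') := by
    intro a b b' c' c'' a''; abel
  refine ⟨M, α, β, γ, ⟨fun x => ⟨key0 _ _ _, ?_⟩, fun x y z h0 => ?_, fun x y z h0 hw => ?_⟩, ?_⟩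
  · -- weights vanish on the matching
    obtain ⟨-, -, -, hsum⟩ := hmem x
    have : α x.1 + β x.1 + γ x.1 =
        (ρA x.1.1 x.1.2.1 + ρB x.1.1 x.1.2.2.1 + ρC x.1.1 x.1.2.2.2 - r x.1.1) ^ 2 := by
      simp only [hα, hβ, hγ]; ring
    rw [this, hsum, sub_self, zero_pow two_ne_zero]
  · -- nonnegativity: the STPP identifies the indices and three of the six elements
    obtain ⟨ha, hb, hc, -⟩ := hmem x
    obtain ⟨ha', hb', hc', -⟩ := hmem y
    obtain ⟨ha'', hb'', hc'', -⟩ := hmem z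
    have h0' : (x.1.2.1 - z.1.2.1) + (y.1.2.2.1 - x.1.2.2.1) + (z.1.2.2.2 - y.1.2.2.2) = 0 := by
      rw [key1]; exact h0
    obtain ⟨hij, hjk, haa, hbb, hcc⟩ := hS x.1.1 y.1.1 z.1.1 _ ha'' _ ha _ hb _ hb' _ hc' _ hc'' h0'
    have : α x.1 + β y.1 + γ z.1 =
        (ρA x.1.1 x.1.2.1 + ρB x.1.1 x.1.2.2.1 + ρC y.1.1 y.1.2.2.2 - r x.1.1) ^ 2 := by
      simp only [hα, hβ, hγ]
      rw [← hjk, ← hij, haa, ← hbb, hcc]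
      ring
    rw [this]
    exact sq_nonneg _
  · -- vanishing forces the matching
    obtain ⟨ha, hb, hc, hx⟩ := hmem x
    obtain ⟨ha', hb', hc', hy⟩ := hmem y
    obtain ⟨ha'', hb'', hc'', hz⟩ := hmem z
    have h0' : (x.1.2.1 - z.1.2.1) + (y.1.2.2.1 - x.1.2.2.1) + (z.1.2.2.2 - y.1.2.2.2) = 0 := by
      rw [key1]; exact h0
    obtain ⟨hij, hjk, haa, hbb, hcc⟩ := hS x.1.1 y.1.1 z.1.1 _ ha'' _ ha _ hb _ hb' _ hc' _ hc'' h0'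
    have hsq : α x.1 + β y.1 + γ z.1 =
        (ρA x.1.1 x.1.2.1 + ρB x.1.1 x.1.2.2.1 + ρC y.1.1 y.1.2.2.2 - r x.1.1) ^ 2 := by
      simp only [hα, hβ, hγ]
      rw [← hjk, ← hij, haa, ← hbb, hcc]
      ring
    rw [hsq] at hw
    have hw' : ρA x.1.1 x.1.2.1 + ρB x.1.1 x.1.2.2.1 + ρC y.1.1 y.1.2.2.2 = r x.1.1 := by
      have := pow_eq_zero_iff (n := 2) two_ne_zero |>.1 hw
      linarith
    -- compare with the three membership equations
    obtain ⟨⟨i, a, b, c⟩, hxM⟩ := x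
    obtain ⟨⟨j, a', b', c'⟩, hyM⟩ := y
    obtain ⟨⟨k, a'', b'', c''⟩, hzM⟩ := z
    simp only at hij hjk haa hbb hcc hx hy hz hw' ha hb hc ha' hb' hc' ha'' hb'' hc'' ⊢
    subst hij hjk
    have hc1 : c = c' := by
      refine finsetRank_injOn hc hc' ?_
      have : ρC i c = ρC i c' := by linarith
      simpa [hρC] using this
    have ha1 : a' = a := by
      refine finsetRank_injOn ha' ha ?_
      rw [← hbb] at hy
      have : ρA i a' = ρA i a := by linarith
      simpa [hρA] using this
    have hb1 : b'' = b := by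
      refine finsetRank_injOn hb'' hb ?_
      rw [haa, ← hcc] at hz
      have : ρB i b'' = ρB i b := by linarith
      simpa [hρB] using this
    refine ⟨Subtype.ext ?_, Subtype.ext ?_⟩
    · simp only [Sigma.mk.injEq, heq_eq_eq, Prod.mk.injEq, true_and]
      exact ⟨ha1.symm, hbb, hc1⟩
    · simp only [Sigma.mk.injEq, heq_eq_eq, Prod.mk.injEq, true_and]
      exact ⟨ha1.trans haa.symm, hbb.symm.trans hb1.symm, hcc⟩
  · -- size
    rw [hM, Finset.card_sigma, Nat.cast_sum]
    refine Finset.sum_le_sum fun i _ => ?_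
    have h := hr i
    rcases Nat.eq_zero_or_pos ((A i).card + (B i).card + (C i).card) with h0 | hpos
    · have hA : (A i).card = 0 := by omega
      simp [hA]
    · rw [div_le_iff₀ (by exact_mod_cast hpos)]
      calc ((A i).card * (B i).card * (C i).card : ℝ)
          ≤ (((A i).card + (B i).card + (C i).card) * (Mi i).card : ℕ) := by exact_mod_cast h
        _ = ((Mi i).card : ℝ) * ((A i).card + (B i).card + (C i).card) := by push_cast; ring

end STPP

end Literature.Combinatorics.Additive
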